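import Literature.MathematicalPhysics.QuantumFieldTheory.Balaban1983to89.Beta.SecondOrderResponse

/-!
# `BalabanUV.Beta.GAN24.Push4` — binder row G-an2-4 / (CONV-C), W-slot road «W3» (SKELETON-W3 v0.2 §2 W3-L1 / §7.4 (F1)): THE FOUR-LEG
# PUSH CARRIER `push₄` — the `K`-free form of the linear part of an2's `T2Of` recursion, its leg families, and the READ IDENTITY
# `mmRead N (K ∘ vertex2OfK K N X ∘ K) = push₄ (rowM K N) (colH K N) X` for ff-valued tables (hypothesis-free in `K`)

NOT IN PRINT; OUR PROOF ATTEMPT (G-an2-4 formalisation swarm, leaf prover `b2b-balaban-gan24-formalise-leaf-17`, gen 14; the row owner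
gan24-p1-g5's RULINGS-12 (R12-7) invitation «W3-L1 `Push4`», module name per (R12-5); PROVISIONAL — the owner may rename / re-cut).
HONEST FRAMING (cell contract, verbatim): «discharging `BetaPertH` makes Bałaban's UV stability UNCONDITIONAL — a real constructive-QFT result;
it is NOT the continuum limit and NOT the Clay problem.»  HONEST DEPENDENCY (verbatim): «continuum YM on T⁴ ⇐ BetaPertH ∧ nine spine estimates
(0/9 proved); BetaPertH ⇐ (D1) ∧ (D4) ∧ CAP+tail; G-an2-4 gates asym, D1 and NE2/3/4.»

WHAT.  an2's second-order carrier `SecondOrderResponse.W2SymOfK K N S M S₂ M₂` sees its bi-stencil slot `S₂` ONLY through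
`vertex2OfK K N S₂` (two `colH K N` weights on the two table legs), and `BalabanStepW2.K3OfK` sees the resulting `W` ONLY through the sandwich
`−K ∘ W ∘ K`, read by `BalabanStepJetsSucc.mmRead N` on the coarse multiplier points (SKELETON-W3 §1.2; `T2SlotUnits.unitS₂_T2Of_succ`, p209782).
Hence the part of the normalised recursion `T̃₂(j+1) = 𝒜_j[T̃₂(j)] + b_j` that is LINEAR in the table reads FOUR response legs of `K` and
nothing else: the two table legs through `colH K N`, the right kernel leg through `colH K N`, the left kernel leg through the mf-ROW family
`rowM K N α x′ κ x := K (N•x′) x (inr α) (inl κ)`.  This module types that structure ONCE, `K`-free: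
* §1 LEG FAMILIES `r : Fin (d+1) → Site → Fin (d+1) → Site → ℝ` (coarse bond → fine bond weights): `rowM` (new) next to an4's `colH` (by name);
  their COMPOSITION `legComp r₂ r₁ μ y κ u := Σ'_v Σ_λ r₁ μ y λ v · r₂ λ v κ u` (coarse ← middle ← fine; the `comp` summation order).
* §2 GENERALISED CHAIN-RULE VERTICES `vertexW r S`, `vertex2W r X` with **`vertexOfK K N = vertexW (colH K N)`**, **`vertex2OfK K N = vertex2W (colH K N)`**
  BY `rfl` (so every an2/an4 socket keeps applying by name).
* §3 LEG KERNELS `Lk l` / `Rk r` (ff-supported kernels carrying the left / right kernel-leg weights) with the summability-FREE composition laws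
  **`comp (Lk l₁) (Lk l₂) = Lk (legComp l₂ l₁)`**, **`comp (Rk r₂) (Rk r₁) = Rk (legComp r₂ r₁)`**, and the ff-corner read `ffRead`.
* §4 **`push₄ l r X μ y ν y′ := ffRead (comp (comp (Lk l) (vertex2W r X μ y ν y′)) (Rk r))`** — THE FOUR-LEG PUSH.
* §5 ff-VALUED kernels/tables (`IsFF`): `mmRead`, `ffRead`, `push₄` are ff-valued; `wsum`/`vertexW`/`vertex2W` of ff-valued tables are ff-valued.
* §6 **THE READ IDENTITY** (hypothesis-free in `K`, no decay, no Fubini — finite fibre-sum splitting only): for every ff-valued kernel `V`,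
  `mmRead N (comp (comp K V) K) = ffRead (comp (comp (Lk (rowM K N)) V) (Rk (colH K N)))` (`mmRead_sandwich_eq`), whence for every table `X`
  with ff-valued entries **`mmRead N (comp (comp K (vertex2OfK K N X μ y ν y′)) K) = push₄ (rowM K N) (colH K N) X μ y ν y′`** (`mmRead_sandwich_vertex2OfK_eq_push₄`)
  — the `𝒜_j`-part of SKELETON-W3 §1.2 is `−(cE₂·Lc^{2(d+1)}) • ½•(push₄ … μ y ν y′ + push₄ … ν y′ μ y)` on the ff-valued part of the table
  (the instantiation to `T2SlotUnits` / leaf-04's `lin4` is the successor module `T2LinearPartEq`; the NESTING `push₄ l₁ r₁ ∘ push₄ l₂ r₂ =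
  push₄ (legComp l₂ l₁) (legComp r₂ r₁)` under exponential majorants is `Push4Nest`).
[folklore] throughout: definitions + finite-sum / `tsum`-of-zero bookkeeping; 0 cited facts, 0 `Prop` mirrors, 0 sorry.  Asserts NO shape of
Bałaban's tables; «T2Shape» / «T2SupRate» LOCATED / OPEN, NOT IN PRINT; discharges NOTHING of (hW, hWall); 0 wall binders instantiated;
NOT «W-slot closed», NEVER «G-an2-4 closed»; NOT BetaPertH, NOT continuum, NOT Clay.
-/

noncomputable section

open Finset
open scoped BigOperators
open Literature.MathematicalPhysics.QuantumFieldTheory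
open Literature.MathematicalPhysics.QuantumFieldTheory.Balaban1983to89
open Literature.MathematicalPhysics.QuantumFieldTheory.Balaban1983to89.Beta
open ExpKernelCalculus (MKer comp)
open OneStepResolventKernel (Fib wsum)
open OneStepKernelFamily (colH vertexOfK)
open BalabanStepJetsSucc (mmRead mmRead_inl_inl mmRead_inr_left mmRead_inr_right)
open SecondOrderResponse (vertex2OfK)

namespace Summit.QuantumFields.BalabanUV.Beta.GAN24.Push4

variable {d : ℕ}

/-! ## §1 Leg families and their composition -/

/-- [folklore] **THE mf-ROW FAMILY** of a packed kernel at blocking `N`: `rowM K N α x′ κ x := K (N•x′) x (inr α) (inl κ)` — the weight with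
which the LEFT kernel leg of a sandwich `K ∘ V ∘ K` read at the coarse multiplier point `(N•x′, α)` sees the fine field index `(x, κ)` of `V`.
(The companion of an4's `colH K N β z′ κ z = K z (N•z′) (inl κ) (inr β)`, which the right kernel leg and both table legs see.) -/
def rowM (K : MKer (d + 1) (Fib d)) (N : ℕ) (α : Fin (d + 1)) (x' : Fin (d + 1) → ℤ) (κ : Fin (d + 1)) (x : Fin (d + 1) → ℤ) : ℝ :=
  K ((N : ℤ) • x') x (Sum.inr α) (Sum.inl κ)

/-- [folklore] `rowM`, by `rfl`. -/
@[simp] theorem rowM_apply (K : MKer (d + 1) (Fib d)) (N : ℕ) (α : Fin (d + 1)) (x' : Fin (d + 1) → ℤ) (κ : Fin (d + 1))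
    (x : Fin (d + 1) → ℤ) : rowM K N α x' κ x = K ((N : ℤ) • x') x (Sum.inr α) (Sum.inl κ) := rfl

/-- [folklore] `colH` read pointwise (an4's definition, restated by `rfl` for `simp`). -/
theorem colH_apply' (K : MKer (d + 1) (Fib d)) (N : ℕ) (β : Fin (d + 1)) (z' : Fin (d + 1) → ℤ) (κ : Fin (d + 1))
    (z : Fin (d + 1) → ℤ) : colH K N β z' κ z = K z ((N : ℤ) • z') (Sum.inl κ) (Sum.inr β) := rfl

/-- [folklore] **COMPOSITION OF LEG FAMILIES** (coarse ← middle ← fine): `legComp r₂ r₁ μ y κ u := Σ'_v Σ_λ r₁ μ y λ v · r₂ λ v κ u` — first `r₁`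
from the coarse bond `(μ, y)` to the middle bond `(λ, v)`, then `r₂` to the fine bond `(κ, u)`.  Written in the summation order of
`ExpKernelCalculus.comp` (`Σ'` outside, finite fibre sum inside), so that the leg-kernel composition laws of §3 hold WITHOUT summability. -/
def legComp (r₂ r₁ : Fin (d + 1) → (Fin (d + 1) → ℤ) → Fin (d + 1) → (Fin (d + 1) → ℤ) → ℝ)
    (μ : Fin (d + 1)) (y : Fin (d + 1) → ℤ) (κ : Fin (d + 1)) (u : Fin (d + 1) → ℤ) : ℝ :=
  ∑' v : Fin (d + 1) → ℤ, ∑ lam : Fin (d + 1), r₁ μ y lam v * r₂ lam v κ u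

/-- [folklore] `legComp`, by `rfl`. -/
theorem legComp_apply (r₂ r₁ : Fin (d + 1) → (Fin (d + 1) → ℤ) → Fin (d + 1) → (Fin (d + 1) → ℤ) → ℝ)
    (μ : Fin (d + 1)) (y : Fin (d + 1) → ℤ) (κ : Fin (d + 1)) (u : Fin (d + 1) → ℤ) :
    legComp r₂ r₁ μ y κ u = ∑' v : Fin (d + 1) → ℤ, ∑ lam : Fin (d + 1), r₁ μ y lam v * r₂ lam v κ u := rfl

/-! ## §2 The generalised chain-rule vertices: an4's `vertexOfK` and an2's `vertex2OfK` depend on `K` only through `colH K N` -/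

/-- [folklore] **THE CHAIN-RULE VERTEX THROUGH AN ARBITRARY LEG FAMILY**: `vertexW r S μ y := Σ_κ wsum (r μ y κ) (S κ)` (an4's `vertexOfK`
with the weights `colH K N` replaced by `r`). -/
def vertexW (r : Fin (d + 1) → (Fin (d + 1) → ℤ) → Fin (d + 1) → (Fin (d + 1) → ℤ) → ℝ)
    (S : Fin (d + 1) → (Fin (d + 1) → ℤ) → MKer (d + 1) (Fib d)) (μ : Fin (d + 1)) (y : Fin (d + 1) → ℤ) : MKer (d + 1) (Fib d) :=
  fun x z a b => ∑ κ : Fin (d + 1), wsum (r μ y κ) (S κ) x z a b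

/-- [folklore] `vertexW` read pointwise. -/
theorem vertexW_apply (r : Fin (d + 1) → (Fin (d + 1) → ℤ) → Fin (d + 1) → (Fin (d + 1) → ℤ) → ℝ)
    (S : Fin (d + 1) → (Fin (d + 1) → ℤ) → MKer (d + 1) (Fib d)) (μ : Fin (d + 1)) (y : Fin (d + 1) → ℤ)
    (x z : Fin (d + 1) → ℤ) (a b : Fib d) :
    vertexW r S μ y x z a b = ∑ κ : Fin (d + 1), ∑' u : Fin (d + 1) → ℤ, r μ y κ u * S κ u x z a b := rfl

/-- [folklore] **an4's VERTEX IS `vertexW` OF ITS `ℋ`-COLUMN FAMILY**, by `rfl`. -/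
theorem vertexOfK_eq_vertexW (K : MKer (d + 1) (Fib d)) (N : ℕ) (S : Fin (d + 1) → (Fin (d + 1) → ℤ) → MKer (d + 1) (Fib d)) :
    vertexOfK K N S = vertexW (colH K N) S := rfl

/-- [folklore] **THE SECOND-ORDER VERTEX THROUGH AN ARBITRARY LEG FAMILY**: both table legs of a bi-stencil table `X κ u κ′ u′` read through `r`
— `vertex2W r X μ y ν y′ := vertexW r (fun κ u ↦ vertexW r (X κ u) ν y′) μ y` (an2's `vertex2OfK` with `colH K N` replaced by `r`). -/
def vertex2W (r : Fin (d + 1) → (Fin (d + 1) → ℤ) → Fin (d + 1) → (Fin (d + 1) → ℤ) → ℝ)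
    (X : Fin (d + 1) → (Fin (d + 1) → ℤ) → Fin (d + 1) → (Fin (d + 1) → ℤ) → MKer (d + 1) (Fib d))
    (μ : Fin (d + 1)) (y : Fin (d + 1) → ℤ) (ν : Fin (d + 1)) (y' : Fin (d + 1) → ℤ) : MKer (d + 1) (Fib d) :=
  vertexW r (fun κ u => vertexW r (X κ u) ν y') μ y

/-- [folklore] **an2's SECOND-ORDER VERTEX IS `vertex2W` OF THE `ℋ`-COLUMN FAMILY**, by `rfl`. -/
theorem vertex2OfK_eq_vertex2W (K : MKer (d + 1) (Fib d)) (N : ℕ)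
    (X : Fin (d + 1) → (Fin (d + 1) → ℤ) → Fin (d + 1) → (Fin (d + 1) → ℤ) → MKer (d + 1) (Fib d)) :
    vertex2OfK K N X = vertex2W (colH K N) X := rfl

/-! ## §3 Leg kernels: the kernel legs of the sandwich as compositions with ff-supported kernels -/

/-- [folklore] **LEFT LEG KERNEL** of a leg family: `Lk l x′ x (inl α) (inl κ) := l α x′ κ x`, all other fibre blocks `0`.  For `l = rowM K N` this
is the part of `K (N•x′) x (inr α) ·` that an ff-valued kernel on its right can see, placed in the ff block of the coarse/fine index pair. -/
def Lk (l : Fin (d + 1) → (Fin (d + 1) → ℤ) → Fin (d + 1) → (Fin (d + 1) → ℤ) → ℝ) : MKer (d + 1) (Fib d) :=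
  fun x' x a b =>
    match a, b with
    | Sum.inl α, Sum.inl κ => l α x' κ x
    | Sum.inl _, Sum.inr _ => 0
    | Sum.inr _, Sum.inl _ => 0
    | Sum.inr _, Sum.inr _ => 0

/-- [folklore] **RIGHT LEG KERNEL** of a leg family: `Rk r z z′ (inl κ) (inl β) := r β z′ κ z`, all other fibre blocks `0`.  For `r = colH K N`
this is the part of `K z (N•z′) · (inr β)` that an ff-valued kernel on its left can see. -/
def Rk (r : Fin (d + 1) → (Fin (d + 1) → ℤ) → Fin (d + 1) → (Fin (d + 1) → ℤ) → ℝ) : MKer (d + 1) (Fib d) :=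
  fun z z' a b =>
    match a, b with
    | Sum.inl κ, Sum.inl β => r β z' κ z
    | Sum.inl _, Sum.inr _ => 0
    | Sum.inr _, Sum.inl _ => 0
    | Sum.inr _, Sum.inr _ => 0

/-- [folklore] **THE ff-CORNER READ**: keep the field–field block of a kernel, zero elsewhere. -/
def ffRead (W : MKer (d + 1) (Fib d)) : MKer (d + 1) (Fib d) :=
  fun x z a b =>
    match a, b with
    | Sum.inl α, Sum.inl β => W x z (Sum.inl α) (Sum.inl β)
    | Sum.inl _, Sum.inr _ => 0
    | Sum.inr _, Sum.inl _ => 0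
    | Sum.inr _, Sum.inr _ => 0

variable (l r r₁ r₂ l₁ l₂ : Fin (d + 1) → (Fin (d + 1) → ℤ) → Fin (d + 1) → (Fin (d + 1) → ℤ) → ℝ)

/-- [folklore] `Lk`: field–field entry. -/
@[simp] theorem Lk_inl_inl (x' x : Fin (d + 1) → ℤ) (α κ : Fin (d + 1)) : Lk l x' x (Sum.inl α) (Sum.inl κ) = l α x' κ x := rfl
/-- [folklore] `Lk`: field–multiplier entry vanishes. -/
@[simp] theorem Lk_inl_inr (x' x : Fin (d + 1) → ℤ) (α ν : Fin (d + 1)) : Lk l x' x (Sum.inl α) (Sum.inr ν) = 0 := rfl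
/-- [folklore] `Lk`: multiplier rows vanish. -/
@[simp] theorem Lk_inr (x' x : Fin (d + 1) → ℤ) (μ : Fin (d + 1)) (b : Fib d) : Lk l x' x (Sum.inr μ) b = 0 := by
  cases b <;> rfl
/-- [folklore] `Rk`: field–field entry. -/
@[simp] theorem Rk_inl_inl (z z' : Fin (d + 1) → ℤ) (κ β : Fin (d + 1)) : Rk r z z' (Sum.inl κ) (Sum.inl β) = r β z' κ z := rfl
/-- [folklore] `Rk`: multiplier rows vanish. -/
@[simp] theorem Rk_inr_left (z z' : Fin (d + 1) → ℤ) (μ : Fin (d + 1)) (b : Fib d) : Rk r z z' (Sum.inr μ) b = 0 := by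
  cases b <;> rfl
/-- [folklore] `Rk`: multiplier columns vanish. -/
@[simp] theorem Rk_inr_right (z z' : Fin (d + 1) → ℤ) (a : Fib d) (ν : Fin (d + 1)) : Rk r z z' a (Sum.inr ν) = 0 := by
  cases a <;> rfl
/-- [folklore] `ffRead`: field–field entry is read through. -/
@[simp] theorem ffRead_inl_inl (W : MKer (d + 1) (Fib d)) (x z : Fin (d + 1) → ℤ) (α β : Fin (d + 1)) :
    ffRead W x z (Sum.inl α) (Sum.inl β) = W x z (Sum.inl α) (Sum.inl β) := rfl
/-- [folklore] `ffRead`: multiplier rows vanish. -/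
@[simp] theorem ffRead_inr_left (W : MKer (d + 1) (Fib d)) (x z : Fin (d + 1) → ℤ) (μ : Fin (d + 1)) (b : Fib d) :
    ffRead W x z (Sum.inr μ) b = 0 := by
  cases b <;> rfl
/-- [folklore] `ffRead`: multiplier columns vanish. -/
@[simp] theorem ffRead_inr_right (W : MKer (d + 1) (Fib d)) (x z : Fin (d + 1) → ℤ) (a : Fib d) (ν : Fin (d + 1)) :
    ffRead W x z a (Sum.inr ν) = 0 := by
  cases a <;> rfl

/-- [folklore] **LEFT LEG KERNELS COMPOSE BY `legComp`** — `comp (Lk l₁) (Lk l₂) = Lk (legComp l₂ l₁)` (no summability needed: the two `Σ'`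
have the same summand after the finite fibre sum is split). -/
theorem comp_Lk_Lk : comp (Lk l₁) (Lk l₂) = Lk (legComp l₂ l₁) := by
  funext x'' x a b
  rcases a with α | μ
  · rcases b with κ | ν
    · simp only [comp, Lk_inl_inl, legComp_apply]
      refine tsum_congr fun x' => ?_
      rw [Fintype.sum_sum_type]
      simp only [Lk_inl_inl, Lk_inr, mul_zero, Finset.sum_const_zero, add_zero]
    · simp only [comp, Lk_inl_inr]
      rw [show (fun y : Fin (d + 1) → ℤ => ∑ f : Fib d, Lk l₁ x'' y (Sum.inl α) f * Lk l₂ y x f (Sum.inr ν)) = fun _ => 0 from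
        funext fun y => Finset.sum_eq_zero fun f _ => by cases f <;> simp, tsum_zero]
  · simp only [comp, Lk_inr, zero_mul, Finset.sum_const_zero, tsum_zero]

/-- [folklore] **RIGHT LEG KERNELS COMPOSE BY `legComp`** — `comp (Rk r₂) (Rk r₁) = Rk (legComp r₂ r₁)` (no summability needed). -/
theorem comp_Rk_Rk : comp (Rk r₂) (Rk r₁) = Rk (legComp r₂ r₁) := by
  funext z z'' a b
  rcases a with κ | μ
  · rcases b with β | ν
    · simp only [comp, Rk_inl_inl, legComp_apply]
      refine tsum_congr fun z' => ?_
      rw [Fintype.sum_sum_type]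
      simp only [Rk_inl_inl, Rk_inr_left, mul_zero, Finset.sum_const_zero, add_zero]
      exact Finset.sum_congr rfl fun lam _ => mul_comm _ _
    · simp only [comp, Rk_inr_right, mul_zero, Finset.sum_const_zero, tsum_zero]
  · simp only [comp, Rk_inr_left, zero_mul, Finset.sum_const_zero, tsum_zero]

/-! ## §4 The four-leg push -/

/-- [folklore] **THE FOUR-LEG PUSH** of a bi-stencil table `X` through the leg families `(l, r)`: the two TABLE legs read through `r` (`vertex2W`),
the LEFT kernel leg through `l` (`Lk`), the RIGHT kernel leg through `r` (`Rk`), and the result read in the ff corner of the coarse indices —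
`push₄ l r X μ y ν y′ := ffRead (comp (comp (Lk l) (vertex2W r X μ y ν y′)) (Rk r))`.  For `(l, r) = (rowM K N, colH K N)` and ff-valued `X`
this IS `mmRead N (K ∘ vertex2OfK K N X μ y ν y′ ∘ K)` (§6). -/
def push₄ (X : Fin (d + 1) → (Fin (d + 1) → ℤ) → Fin (d + 1) → (Fin (d + 1) → ℤ) → MKer (d + 1) (Fib d))
    (μ : Fin (d + 1)) (y : Fin (d + 1) → ℤ) (ν : Fin (d + 1)) (y' : Fin (d + 1) → ℤ) : MKer (d + 1) (Fib d) :=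
  ffRead (comp (comp (Lk l) (vertex2W r X μ y ν y')) (Rk r))

/-- [folklore] `push₄`, by `rfl`. -/
theorem push₄_def (X : Fin (d + 1) → (Fin (d + 1) → ℤ) → Fin (d + 1) → (Fin (d + 1) → ℤ) → MKer (d + 1) (Fib d))
    (μ : Fin (d + 1)) (y : Fin (d + 1) → ℤ) (ν : Fin (d + 1)) (y' : Fin (d + 1) → ℤ) :
    push₄ l r X μ y ν y' = ffRead (comp (comp (Lk l) (vertex2W r X μ y ν y')) (Rk r)) := rfl

/-- [folklore] **THE ENTRY FORMULA** of the push: for field indices,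
`push₄ l r X μ y ν y′ x′ z′ (inl α) (inl β) = Σ'_z Σ_{κ₂} (Σ'_x Σ_{κ₁} l α x′ κ₁ x · (vertex2W r X μ y ν y′) x z (inl κ₁) (inl κ₂)) · r β z′ κ₂ z`. -/
theorem push₄_inl_inl (X : Fin (d + 1) → (Fin (d + 1) → ℤ) → Fin (d + 1) → (Fin (d + 1) → ℤ) → MKer (d + 1) (Fib d))
    (μ : Fin (d + 1)) (y : Fin (d + 1) → ℤ) (ν : Fin (d + 1)) (y' : Fin (d + 1) → ℤ) (x' z' : Fin (d + 1) → ℤ) (α β : Fin (d + 1)) :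
    push₄ l r X μ y ν y' x' z' (Sum.inl α) (Sum.inl β)
      = ∑' z : Fin (d + 1) → ℤ, ∑ κ₂ : Fin (d + 1),
          (∑' x : Fin (d + 1) → ℤ, ∑ κ₁ : Fin (d + 1), l α x' κ₁ x * vertex2W r X μ y ν y' x z (Sum.inl κ₁) (Sum.inl κ₂)) * r β z' κ₂ z := by
  simp only [push₄, ffRead_inl_inl, comp]
  refine tsum_congr fun z => ?_
  rw [Fintype.sum_sum_type]
  simp only [Rk_inl_inl, Rk_inr_left, mul_zero, Finset.sum_const_zero, add_zero]
  refine Finset.sum_congr rfl fun κ₂ _ => ?_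
  congr 1
  refine tsum_congr fun x => ?_
  rw [Fintype.sum_sum_type]
  simp only [Lk_inl_inl, Lk_inl_inr, zero_mul, Finset.sum_const_zero, add_zero]

/-! ## §5 ff-valued kernels and tables -/

/-- [folklore] A kernel is ff-VALUED when all its blocks with a multiplier index vanish. -/
def IsFF (V : MKer (d + 1) (Fib d)) : Prop :=
  (∀ (x z : Fin (d + 1) → ℤ) (μ : Fin (d + 1)) (b : Fib d), V x z (Sum.inr μ) b = 0) ∧
    ∀ (x z : Fin (d + 1) → ℤ) (a : Fib d) (ν : Fin (d + 1)), V x z a (Sum.inr ν) = 0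

/-- [folklore] `ffRead W` is ff-valued. -/
theorem isFF_ffRead (W : MKer (d + 1) (Fib d)) : IsFF (ffRead W) :=
  ⟨fun x z μ b => ffRead_inr_left W x z μ b, fun x z a ν => ffRead_inr_right W x z a ν⟩

/-- [folklore] `mmRead N F` is ff-valued. -/
theorem isFF_mmRead (N : ℕ) (F : MKer (d + 1) (Fib d)) : IsFF (mmRead N F) :=
  ⟨fun x z μ b => mmRead_inr_left N F x z μ b, fun x z a ν => mmRead_inr_right N F x z a ν⟩

/-- [folklore] `push₄ l r X μ y ν y′` is ff-valued (whatever `X` is). -/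
theorem isFF_push₄ (X : Fin (d + 1) → (Fin (d + 1) → ℤ) → Fin (d + 1) → (Fin (d + 1) → ℤ) → MKer (d + 1) (Fib d))
    (μ : Fin (d + 1)) (y : Fin (d + 1) → ℤ) (ν : Fin (d + 1)) (y' : Fin (d + 1) → ℤ) : IsFF (push₄ l r X μ y ν y') :=
  isFF_ffRead _

/-- [folklore] An ff-valued kernel IS its ff-corner read. -/
theorem ffRead_eq_self_of_isFF {V : MKer (d + 1) (Fib d)} (hV : IsFF V) : ffRead V = V := by
  funext x z a b
  rcases a with α | μ
  · rcases b with β | ν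
    · rfl
    · rw [ffRead_inr_right, hV.2]
  · rw [ffRead_inr_left, hV.1]

/-- [folklore] A weighted superposition of ff-valued kernels is ff-valued (termwise zero, no summability needed). -/
theorem isFF_wsum {w : (Fin (d + 1) → ℤ) → ℝ} {S : (Fin (d + 1) → ℤ) → MKer (d + 1) (Fib d)} (hS : ∀ u, IsFF (S u)) :
    IsFF (wsum w S) := by
  refine ⟨fun x z μ b => ?_, fun x z a ν => ?_⟩
  · show ∑' u, w u * S u x z (Sum.inr μ) b = 0
    rw [show (fun u => w u * S u x z (Sum.inr μ) b) = fun _ => 0 from funext fun u => by rw [(hS u).1, mul_zero], tsum_zero]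
  · show ∑' u, w u * S u x z a (Sum.inr ν) = 0
    rw [show (fun u => w u * S u x z a (Sum.inr ν)) = fun _ => 0 from funext fun u => by rw [(hS u).2, mul_zero], tsum_zero]

/-- [folklore] The chain-rule vertex of a family of ff-valued stencil entries is ff-valued. -/
theorem isFF_vertexW {S : Fin (d + 1) → (Fin (d + 1) → ℤ) → MKer (d + 1) (Fib d)} (hS : ∀ κ u, IsFF (S κ u))
    (μ : Fin (d + 1)) (y : Fin (d + 1) → ℤ) : IsFF (vertexW r S μ y) := by
  refine ⟨fun x z μ' b => ?_, fun x z a ν => ?_⟩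
  · show ∑ κ, wsum (r μ y κ) (S κ) x z (Sum.inr μ') b = 0
    exact Finset.sum_eq_zero fun κ _ => (isFF_wsum (fun u => hS κ u)).1 x z μ' b
  · show ∑ κ, wsum (r μ y κ) (S κ) x z a (Sum.inr ν) = 0
    exact Finset.sum_eq_zero fun κ _ => (isFF_wsum (fun u => hS κ u)).2 x z a ν

/-- [folklore] The second-order vertex of a table with ff-valued entries is ff-valued. -/
theorem isFF_vertex2W {X : Fin (d + 1) → (Fin (d + 1) → ℤ) → Fin (d + 1) → (Fin (d + 1) → ℤ) → MKer (d + 1) (Fib d)}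
    (hX : ∀ κ u κ' u', IsFF (X κ u κ' u')) (μ : Fin (d + 1)) (y : Fin (d + 1) → ℤ) (ν : Fin (d + 1)) (y' : Fin (d + 1) → ℤ) :
    IsFF (vertex2W r X μ y ν y') :=
  isFF_vertexW r (fun κ u => isFF_vertexW r (hX κ u) ν y') μ y

/-- [folklore] For `K`: an2's `vertex2OfK` of a table with ff-valued entries is ff-valued. -/
theorem isFF_vertex2OfK (K : MKer (d + 1) (Fib d)) (N : ℕ)
    {X : Fin (d + 1) → (Fin (d + 1) → ℤ) → Fin (d + 1) → (Fin (d + 1) → ℤ) → MKer (d + 1) (Fib d)}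
    (hX : ∀ κ u κ' u', IsFF (X κ u κ' u')) (μ : Fin (d + 1)) (y : Fin (d + 1) → ℤ) (ν : Fin (d + 1)) (y' : Fin (d + 1) → ℤ) :
    IsFF (vertex2OfK K N X μ y ν y') := by
  rw [vertex2OfK_eq_vertex2W]
  exact isFF_vertex2W _ hX μ y ν y'

/-! ## §6 THE READ IDENTITY: the `mm`-read of a sandwich of an ff-valued kernel sees four leg families and nothing else -/

/-- [folklore] **`mmRead N (K ∘ V ∘ K) = ffRead (Lk (rowM K N) ∘ V ∘ Rk (colH K N))` FOR ff-VALUED `V`** — hypothesis-free in `K` (no decay,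
no summability: the `Σ'` on both sides have the same summands once the finite fibre sums are split into field and multiplier parts and the
multiplier parts are seen to vanish termwise). -/
theorem mmRead_sandwich_eq (K : MKer (d + 1) (Fib d)) (N : ℕ) {V : MKer (d + 1) (Fib d)} (hV : IsFF V) :
    mmRead N (comp (comp K V) K) = ffRead (comp (comp (Lk (rowM K N)) V) (Rk (colH K N))) := by
  -- the inner compositions agree on the rows that are read
  have hin : ∀ (x' z : Fin (d + 1) → ℤ) (α : Fin (d + 1)) (b : Fib d),
      comp K V ((N : ℤ) • x') z (Sum.inr α) b = comp (Lk (rowM K N)) V x' z (Sum.inl α) b := by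
    intro x' z α b
    simp only [comp]
    refine tsum_congr fun x => ?_
    rw [Fintype.sum_sum_type, Fintype.sum_sum_type]
    simp only [Lk_inl_inl, rowM_apply, Lk_inl_inr, Finset.sum_const_zero, add_zero, hV.1, mul_zero]
  -- the inner composition has no right multiplier leg
  have hin0 : ∀ (x' z : Fin (d + 1) → ℤ) (α ν : Fin (d + 1)), comp K V ((N : ℤ) • x') z (Sum.inr α) (Sum.inr ν) = 0 := by
    intro x' z α ν
    simp only [comp]
    rw [show (fun y : Fin (d + 1) → ℤ => ∑ f : Fib d, K ((N : ℤ) • x') y (Sum.inr α) f * V y z f (Sum.inr ν)) = fun _ => 0 from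
      funext fun y => Finset.sum_eq_zero fun f _ => by rw [hV.2, mul_zero], tsum_zero]
  funext x' z' a b
  rcases a with α | μ
  · rcases b with β | ν
    · rw [mmRead_inl_inl, ffRead_inl_inl]
      simp only [comp] at hin hin0 ⊢
      refine tsum_congr fun z => ?_
      rw [Fintype.sum_sum_type, Fintype.sum_sum_type]
      simp only [Rk_inl_inl, colH_apply', Rk_inr_left, mul_zero, Finset.sum_const_zero, add_zero, hin0, zero_mul]
      exact Finset.sum_congr rfl fun κ _ => by rw [hin]
    · rw [mmRead_inr_right, ffRead_inr_right]
  · rw [mmRead_inr_left, ffRead_inr_left]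

/-- [folklore] **THE LINEAR PART OF THE SECOND-ORDER READ IS A FOUR-LEG PUSH**: for every packed kernel `K`, every blocking `N` and every
bi-stencil table `X` WITH ff-VALUED ENTRIES,
`mmRead N (comp (comp K (vertex2OfK K N X μ y ν y′)) K) = push₄ (rowM K N) (colH K N) X μ y ν y′`.
This is the `K`-free form of the `𝒜_j`-part of an2's `T2Of` recursion (SKELETON-W3 §1.2: `𝒜_j[X] = −(cE₂·Lc^{2(d+1)}) • mmRead Lc (K̃_j ∘ ½(vertex2OfK
K̃_j Lc X μ y ν y′ + vertex2OfK K̃_j Lc X ν y′ μ y) ∘ K̃_j)` — both summands are pushes, the second with the OUTPUT bonds exchanged). -/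
theorem mmRead_sandwich_vertex2OfK_eq_push₄ (K : MKer (d + 1) (Fib d)) (N : ℕ)
    {X : Fin (d + 1) → (Fin (d + 1) → ℤ) → Fin (d + 1) → (Fin (d + 1) → ℤ) → MKer (d + 1) (Fib d)}
    (hX : ∀ κ u κ' u', IsFF (X κ u κ' u')) (μ : Fin (d + 1)) (y : Fin (d + 1) → ℤ) (ν : Fin (d + 1)) (y' : Fin (d + 1) → ℤ) :
    mmRead N (comp (comp K (vertex2OfK K N X μ y ν y')) K) = push₄ (rowM K N) (colH K N) X μ y ν y' := by
  rw [mmRead_sandwich_eq K N (isFF_vertex2OfK K N hX μ y ν y'), push₄_def, vertex2OfK_eq_vertex2W]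

end Summit.QuantumFields.BalabanUV.Beta.GAN24.Push4

end
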